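import Mathlib
import Summits.ValiantsHypothesis.ValiantsHypothesis.Theses.FifoMatching
import Summits.ValiantsHypothesis.ValiantsHypothesis.Theorems.FifoMatchingNFPolytopeQueueGridPPHardOfCorGridMinor
import Summits.ValiantsHypothesis.ValiantsHypothesis.Theorems.FifoMatchingNFPolytopeQueueGridFaceProjection
import Literature.Combinatorics.Optimization.CorrelationPolytopeGridMinor
import HarnessLib

/-!
# K1 from the WEAKEST hypothesis: the grid-only correlation-polytope bound (socket for the unconditional closer)

Helper (c1 g5; director-valiant R170 (a) / R172 (b)(1)) for stmt-ValiantsHypothesis-26254 (`Theses.FifoMatching.NFPolytopeQuasiPolyXC`,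
K1).  The conditional closer of record `QueueGridFace.nfPolytopeQuasiPolyXC_of_AboulkerEtAl2019` (p618136) assumes the named
print fact `AboulkerEtAl2019_corGridMinor` (grid-MINOR form).  The chain actually consumes only the GRID-ONLY bound

  `hB : ∃ c > 0, ∀ᶠ t, ∀ R, HasEFOfSize (COR(G_{t,t})) R → 2^{c t} ≤ R`

over the Literature module's `Literature.Combinatorics.Optimization.corPolytopeGraph` / `gridGraph` (p615264) — no
minor-monotonicity.  This file lands K1 (the route decl BY NAME) from `hB` in that spelling (`∀ᶠ` form and `∃ t₀` form), so
that the day `hB` is a theorem of the tree (G♭ programme, R170 (b): `GridCorCliqueFace` ⇒ `hB` via Kaibel–Weltge + face /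
linear-image monotonicity) the UNCONDITIONAL closer is the 3-liner
`theorem … : …NFPolytopeQuasiPolyXC := nfPolytopeQuasiPolyXC_of_corGridBound <hB-theorem>` (`--workitem stmt-…-26254`).

Honesty: implications only; K1 stays «closed modulo the print fact» (conditional), HD-1 26253 held, `NNDivisionHard` 21181
untouched, stmt-23918 / 24468 CLOSED untouched; VP ≠ VNP is not moved.  Inputs by name: (A)
`NFPolytopeQuasiPolyXC.QueueGridFace.queueGridFaceProjection` (p617795, qg1 g0), glue `queueGridPPHard_of_corGridBound`
(p615220), bridge `corPolytopeGraph_eq` (p615913), assembly `newtXC_of_inputs` (p615400).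
-/

-- Sub = Summit single-conjunct layout: the duplicated namespace component is mandated by the tree.
set_option linter.dupNamespace false

namespace Summit.ValiantsHypothesis.ValiantsHypothesis.Theorems.FifoMatching.QueueGridFace

open Literature.Barriers.PneNP Literature.Computability.MetaComplexity Filter

/-- **K1 from the grid-only COR bound (`∀ᶠ` form), over the Literature `corPolytopeGraph`.**  The socket for the
unconditional closer. [assembly; R170 (a)] -/
theorem nfPolytopeQuasiPolyXC_of_corGridBound
    (hB : ∃ c : ℝ, 0 < c ∧ ∀ᶠ t : ℕ in atTop, ∀ R : ℕ,
      HasEFOfSize (Literature.Combinatorics.Optimization.corPolytopeGraph (gridGraph t)) R → (2 : ℝ) ^ (c * t) ≤ R) :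
    Summit.ValiantsHypothesis.ValiantsHypothesis.Theses.FifoMatching.NFPolytopeQuasiPolyXC := by
  refine newtXC_of_inputs NFPolytopeQuasiPolyXC.QueueGridFace.queueGridFaceProjection
    (queueGridPPHard_of_corGridBound ?_)
  obtain ⟨c, hc, hev⟩ := hB
  refine ⟨c, hc, hev.mono fun t ht R hR => ht R ?_⟩
  rwa [corPolytopeGraph_eq]

/-- **K1 from the grid-only COR bound (`∃ t₀` form, the shape of `AboulkerEtAl2019_corGridMinor.grid`).** [assembly] -/
theorem nfPolytopeQuasiPolyXC_of_corGridBound'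
    (hB : ∃ c : ℝ, 0 < c ∧ ∃ t₀ : ℕ, ∀ t : ℕ, t₀ ≤ t → ∀ R : ℕ,
      HasEFOfSize (Literature.Combinatorics.Optimization.corPolytopeGraph (gridGraph t)) R → (2 : ℝ) ^ (c * t) ≤ R) :
    Summit.ValiantsHypothesis.ValiantsHypothesis.Theses.FifoMatching.NFPolytopeQuasiPolyXC := by
  obtain ⟨c, hc, t₀, H⟩ := hB
  exact nfPolytopeQuasiPolyXC_of_corGridBound ⟨c, hc, Filter.eventually_atTop.2 ⟨t₀, H⟩⟩

end Summit.ValiantsHypothesis.ValiantsHypothesis.Theorems.FifoMatching.QueueGridFace
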